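import Summits.KontsevichZagierPeriods.KontsevichZagierPeriods.Theorems.FurushoPentagonPentagonInKZCornerReps
import Summits.KontsevichZagierPeriods.KontsevichZagierPeriods.Theorems.FurushoPentagonPentagonInKZCornerBlocks
import Literature.NumberTheory.Transcendental.KZDominatedFamilyRelations
import Literature.NumberTheory.Transcendental.NashCubes
import Literature.NumberTheory.Transcendental.SemialgebraicLineDeriv
import Literature.NumberTheory.Transcendental.Associators

/-!
# `PentagonInKZ`, line `edge-normal-newton-leibniz`: corner engine — collecting the two sides (degree `n − 1`)

Part of the proof of `cornerEngine_uniformlyNull` (crux `FurushoPentagon.PentagonInKZ`,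
stmt-KontsevichZagierPeriods-11348), in the ABSTRACT form of the corner engine: all objects (residues `Zq`,
residue monomials `wZ`, letter densities `fd`, `gd`, `dd`, regularised word integrands `Ht`, `Vt`,
`dHt`, `dVt`, insertion operators `op`, `opV`, transports `Af`, `Bf`, `dAf`, `dBf`, defect `F`,
coordinate blocks `Xb | Yb | Θb`) are hypothesised, and their properties form ONE hypothesis
bundle `H`.  Step A of the engine (peeling the outermost horizontal variable) and its mirror image
(peeling the outermost vertical variable) produce level-`(n−1)` and level-`(n−2)` terms; the mirror
terms live on the cube `[0,1]^{l+k+(e+2)}` in the layout `y | x | θ''` with the two new parameters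
transposed.  This file collects the two sides:

* `collect_op_comm_four_cases` — the four-case commutator identity
  `op_A op_B − op_B op_A = [A, B] · − [both commutators] (· [A, B])` in any ring;
* `sum_weight_commutator` — with `μ(P [Z_ℓ, Z_ℓ'] Q) = 0` and flatness
  `Σ_{a,b} fd_a gd_b μ(P [Z_a, Z_b] Q) = 0`, the weighted sum of the commutators
  `μ(op_a opV_b X) − μ(opV_b op_a X)` vanishes;
* `collect_swap_blocks_rep`, `collect_swap_params_rep`, `collect_unmirror_rep` — reading a
  mirror-layout representation over the direct cube (rule (2) along the block exchange and the
  transposition of the two new parameters);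
* `collect_deg1` — the degree-`(n−1)` cancellation for a letter `c ∉ {ℓ, ℓ'}`: the `dd_c`-terms of
  the two sides differ by (minus) an instance of uniform nullity in degree `n − 1`.

(The degree-`(n−2)` cancellation `collect_deg2` is in `…CornerEngineCollectDeg2.lean`.)

References: [KontsevichZagier2001, §1.2 rules (1), (2)], [Drinfeld1991, §2].
-/

noncomputable section

open Set MeasureTheory
open Literature.NumberTheory.Transcendental
open Literature.ModelTheory.ExponentialFields (IsSemialgebraic)

namespace Summit.KontsevichZagierPeriods.FurushoPentagon.PentagonInKZ

section AbstractEngine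

variable {m N : ℕ} {ℓ ℓ' : Fin (m + 2)} {α β : ℚ}
  {Zq : Fin (m + 2) → (DrinfeldKohnoTrunc ℚ (Fin 4) N)} {wZ : ∀ {n : ℕ}, (Fin n → Fin (m + 2)) → (DrinfeldKohnoTrunc ℚ (Fin 4) N)}
  {fd gd dd : Fin (m + 2) → ℝ → ℝ → ℝ}
  {Ht Vt dHt dVt : ∀ {n : ℕ}, (Fin n → Fin (m + 2)) → (Fin n → ℝ) → ℝ → ℝ → ℝ}
  {op opV : Fin (m + 2) → (DrinfeldKohnoTrunc ℚ (Fin 4) N) →ₗ[ℚ] (DrinfeldKohnoTrunc ℚ (Fin 4) N)}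
  {Af Bf dAf dBf F : ((DrinfeldKohnoTrunc ℚ (Fin 4) N) →ₗ[ℚ] ℚ) → ∀ {k l : ℕ}, (Fin k → ℝ) → (Fin l → ℝ) → ℝ → ℝ → ℝ}
  {Xb : ∀ k l e : ℕ, (Fin (k + l + e) → ℝ) → Fin k → ℝ}
  {Yb : ∀ k l e : ℕ, (Fin (k + l + e) → ℝ) → Fin l → ℝ}
  {Θb : ∀ k l e : ℕ, (Fin (k + l + e) → ℝ) → Fin e → ℝ}

variable (H :
    (∀ {n : ℕ} (U : Fin n → Fin (m + 2)), wZ U = ((List.ofFn U).map Zq).prod) ∧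
    (∀ (a : Fin (m + 2)) (X : (DrinfeldKohnoTrunc ℚ (Fin 4) N)), op a X = if a = ℓ then Zq ℓ * X - X * Zq ℓ else Zq a * X) ∧
    (∀ (b : Fin (m + 2)) (X : (DrinfeldKohnoTrunc ℚ (Fin 4) N)), opV b X = if b = ℓ' then Zq ℓ' * X - X * Zq ℓ' else Zq b * X) ∧
    (∀ (μ : (DrinfeldKohnoTrunc ℚ (Fin 4) N) →ₗ[ℚ] ℚ) {k l : ℕ} (x : Fin k → ℝ) (y : Fin l → ℝ) (ξ η : ℝ), Af μ x y ξ η = ∑ U : Fin k → Fin (m + 2), ∑ V : Fin l → Fin (m + 2), (μ (wZ U * wZ V) : ℝ) * (Ht U x ξ η * Vt V y 0 η)) ∧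
    (∀ (μ : (DrinfeldKohnoTrunc ℚ (Fin 4) N) →ₗ[ℚ] ℚ) {k l : ℕ} (x : Fin k → ℝ) (y : Fin l → ℝ) (ξ η : ℝ), Bf μ x y ξ η = ∑ U : Fin k → Fin (m + 2), ∑ V : Fin l → Fin (m + 2), (μ (wZ V * wZ U) : ℝ) * (Vt V y ξ η * Ht U x ξ 0)) ∧
    (∀ (μ : (DrinfeldKohnoTrunc ℚ (Fin 4) N) →ₗ[ℚ] ℚ) {k l : ℕ} (x : Fin k → ℝ) (y : Fin l → ℝ) (ξ η : ℝ), dAf μ x y ξ η = ∑ U : Fin k → Fin (m + 2), ∑ V : Fin l → Fin (m + 2), (μ (wZ U * wZ V) : ℝ) * (dHt U x ξ η * Vt V y 0 η)) ∧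
    (∀ (μ : (DrinfeldKohnoTrunc ℚ (Fin 4) N) →ₗ[ℚ] ℚ) {k l : ℕ} (x : Fin k → ℝ) (y : Fin l → ℝ) (ξ η : ℝ), dBf μ x y ξ η = ∑ U : Fin k → Fin (m + 2), ∑ V : Fin l → Fin (m + 2), (μ (wZ V * wZ U) : ℝ) * (dVt V y ξ η * Ht U x ξ 0)) ∧
    (∀ (μ : (DrinfeldKohnoTrunc ℚ (Fin 4) N) →ₗ[ℚ] ℚ) {k l : ℕ} (x : Fin k → ℝ) (y : Fin l → ℝ) (ξ η : ℝ), F μ x y ξ η = Af μ x y ξ η - Bf μ x y ξ η) ∧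
    (∀ (k l e : ℕ) (z : Fin (k + l + e) → ℝ), Xb k l e z = fun i => z (Fin.castAdd e (Fin.castAdd l i))) ∧
    (∀ (k l e : ℕ) (z : Fin (k + l + e) → ℝ), Yb k l e z = fun j => z (Fin.castAdd e (Fin.natAdd k j))) ∧
    (∀ (k l e : ℕ) (z : Fin (k + l + e) → ℝ), Θb k l e z = fun s => z (Fin.natAdd (k + l) s)) ∧
    (∀ (U : Fin 0 → Fin (m + 2)) (x : Fin 0 → ℝ) (ξ η : ℝ), Ht U x ξ η = 1) ∧
    (∀ (V : Fin 0 → Fin (m + 2)) (y : Fin 0 → ℝ) (ξ η : ℝ), Vt V y ξ η = 1) ∧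
    (∀ (U : Fin 0 → Fin (m + 2)) (x : Fin 0 → ℝ) (ξ η : ℝ), dHt U x ξ η = 0) ∧
    (∀ (V : Fin 0 → Fin (m + 2)) (y : Fin 0 → ℝ) (ξ η : ℝ), dVt V y ξ η = 0) ∧
    (∀ {k : ℕ} (U : Fin (k + 1) → Fin (m + 2)) (x : Fin (k + 1) → ℝ) (η : ℝ), Ht U x 0 η = 0) ∧
    (∀ {l : ℕ} (V : Fin (l + 1) → Fin (m + 2)) (y : Fin (l + 1) → ℝ) (ξ : ℝ), Vt V y ξ 0 = 0) ∧
    (∀ t y : ℝ, fd ℓ t y = 1 / t) ∧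
    (∀ x s : ℝ, gd ℓ' x s = 1 / s) ∧
    (∀ x y : ℝ, dd ℓ x y = 0) ∧
    (∀ x y : ℝ, dd ℓ' x y = 0) ∧
    (∀ (μ : (DrinfeldKohnoTrunc ℚ (Fin 4) N) →ₗ[ℚ] ℚ) {k : ℕ} (x₀ : ℝ) (x' : Fin k → ℝ) (ξ η : ℝ), ∑ U : Fin (k + 1) → Fin (m + 2), (μ (wZ U) : ℝ) * Ht U (Fin.cons x₀ x') ξ η = (∑ a : Fin (m + 2), (if a = ℓ then 1 / x₀ else ξ * fd a (ξ * x₀) η) * ∑ U' : Fin k → Fin (m + 2), (μ (Zq a * wZ U') : ℝ) * Ht U' x' (ξ * x₀) η) - (1 / x₀) * ∑ U' : Fin k → Fin (m + 2), (μ (wZ U' * Zq ℓ) : ℝ) * Ht U' x' (ξ * x₀) η) ∧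
    (∀ (μ : (DrinfeldKohnoTrunc ℚ (Fin 4) N) →ₗ[ℚ] ℚ) {l : ℕ} (y₀ : ℝ) (y' : Fin l → ℝ) (ξ η : ℝ), ∑ V : Fin (l + 1) → Fin (m + 2), (μ (wZ V) : ℝ) * Vt V (Fin.cons y₀ y') ξ η = (∑ b : Fin (m + 2), (if b = ℓ' then 1 / y₀ else η * gd b ξ (η * y₀)) * ∑ V' : Fin l → Fin (m + 2), (μ (Zq b * wZ V') : ℝ) * Vt V' y' ξ (η * y₀)) - (1 / y₀) * ∑ V' : Fin l → Fin (m + 2), (μ (wZ V' * Zq ℓ') : ℝ) * Vt V' y' ξ (η * y₀)) ∧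
    (∀ (μ : (DrinfeldKohnoTrunc ℚ (Fin 4) N) →ₗ[ℚ] ℚ) {l : ℕ} (P Q : (DrinfeldKohnoTrunc ℚ (Fin 4) N)) (y : Fin l → ℝ) (η : ℝ), (∀ i, 0 < y i ∧ y i < 1) → 0 < η → η ≤ (β : ℝ) → ∑ V : Fin l → Fin (m + 2), (μ (P * (Zq ℓ * wZ V - wZ V * Zq ℓ) * Q) : ℝ) * Vt V y 0 η = 0) ∧
    (∀ (μ : (DrinfeldKohnoTrunc ℚ (Fin 4) N) →ₗ[ℚ] ℚ) {k : ℕ} (P Q : (DrinfeldKohnoTrunc ℚ (Fin 4) N)) (x : Fin k → ℝ) (ξ : ℝ), (∀ i, 0 < x i ∧ x i < 1) → 0 < ξ → ξ ≤ (α : ℝ) → ∑ U : Fin k → Fin (m + 2), (μ (P * (Zq ℓ' * wZ U - wZ U * Zq ℓ') * Q) : ℝ) * Ht U x ξ 0 = 0) ∧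
    (∀ (μ : (DrinfeldKohnoTrunc ℚ (Fin 4) N) →ₗ[ℚ] ℚ) (P Q : (DrinfeldKohnoTrunc ℚ (Fin 4) N)), μ (P * (Zq ℓ * Zq ℓ' - Zq ℓ' * Zq ℓ) * Q) = 0) ∧
    (∀ (μ : (DrinfeldKohnoTrunc ℚ (Fin 4) N) →ₗ[ℚ] ℚ) (P Q : (DrinfeldKohnoTrunc ℚ (Fin 4) N)) (x y : ℝ), 0 < x → x < (α : ℝ) → 0 < y → y < (β : ℝ) → ∑ a : Fin (m + 2), ∑ b : Fin (m + 2), (fd a x y * gd b x y) * (μ (P * (Zq a * Zq b - Zq b * Zq a) * Q) : ℝ) = 0) ∧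
    (∀ (μ : (DrinfeldKohnoTrunc ℚ (Fin 4) N) →ₗ[ℚ] ℚ) (P Q : (DrinfeldKohnoTrunc ℚ (Fin 4) N)) (s : ℝ), 0 < s → s < (β : ℝ) → ∑ b : Fin (m + 2), gd b 0 s * (μ (P * (Zq ℓ * Zq b - Zq b * Zq ℓ) * Q) : ℝ) = 0) ∧
    (∀ (μ : (DrinfeldKohnoTrunc ℚ (Fin 4) N) →ₗ[ℚ] ℚ) (P Q : (DrinfeldKohnoTrunc ℚ (Fin 4) N)) (t : ℝ), 0 < t → t < (α : ℝ) → ∑ a : Fin (m + 2), fd a t 0 * (μ (P * (Zq ℓ' * Zq a - Zq a * Zq ℓ') * Q) : ℝ) = 0) ∧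
    (∀ (a : Fin (m + 2)) (ξ η : ℝ), 0 ≤ ξ → ξ ≤ (α : ℝ) → 0 ≤ η → η ≤ (β : ℝ) → HasDerivAt (fun y => fd a ξ y) (dd a ξ η) η) ∧
    (∀ (b : Fin (m + 2)) (ξ η : ℝ), 0 ≤ ξ → ξ ≤ (α : ℝ) → 0 ≤ η → η ≤ (β : ℝ) → HasDerivAt (fun x => gd b x η) (dd b ξ η) ξ) ∧
    (∀ {k : ℕ} (U : Fin k → Fin (m + 2)) (x : Fin k → ℝ) (ξ η : ℝ), (∀ i, 0 ≤ x i ∧ x i ≤ 1) → 0 ≤ ξ → ξ ≤ (α : ℝ) → 0 ≤ η → η ≤ (β : ℝ) → HasDerivAt (fun t => Ht U x t η) (dHt U x ξ η) ξ) ∧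
    (∀ {l : ℕ} (V : Fin l → Fin (m + 2)) (y : Fin l → ℝ) (ξ η : ℝ), (∀ i, 0 ≤ y i ∧ y i ≤ 1) → 0 ≤ ξ → ξ ≤ (α : ℝ) → 0 ≤ η → η ≤ (β : ℝ) → HasDerivAt (fun s => Vt V y ξ s) (dVt V y ξ η) η) ∧
    (∀ {k : ℕ} (U : Fin (k + 1) → Fin (m + 2)) (x₀ : ℝ) (x' : Fin k → ℝ) (ξ η : ℝ), 0 < x₀ → x₀ < 1 → (∀ i, 0 ≤ x' i ∧ x' i ≤ 1) → 0 ≤ ξ → ξ ≤ (α : ℝ) → 0 ≤ η → η ≤ (β : ℝ) → HasDerivAt (fun t => t * Ht U (Fin.cons t x') ξ η) (ξ * dHt U (Fin.cons x₀ x') ξ η) x₀) ∧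
    (∀ {l : ℕ} (V : Fin (l + 1) → Fin (m + 2)) (y₀ : ℝ) (y' : Fin l → ℝ) (ξ η : ℝ), 0 < y₀ → y₀ < 1 → (∀ i, 0 ≤ y' i ∧ y' i ≤ 1) → 0 ≤ ξ → ξ ≤ (α : ℝ) → 0 ≤ η → η ≤ (β : ℝ) → HasDerivAt (fun t => t * Vt V (Fin.cons t y') ξ η) (η * dVt V (Fin.cons y₀ y') ξ η) y₀) ∧
    (∀ {k : ℕ} (U : Fin (k + 1) → Fin (m + 2)) (x' : Fin k → ℝ) (ξ η : ℝ), (∀ i, 0 ≤ x' i ∧ x' i ≤ 1) → 0 ≤ ξ → ξ ≤ (α : ℝ) → 0 ≤ η → η ≤ (β : ℝ) → ContinuousOn (fun t => t * Ht U (Fin.cons t x') ξ η) (Set.Icc 0 1)) ∧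
    (∀ {l : ℕ} (V : Fin (l + 1) → Fin (m + 2)) (y' : Fin l → ℝ) (ξ η : ℝ), (∀ i, 0 ≤ y' i ∧ y' i ≤ 1) → 0 ≤ ξ → ξ ≤ (α : ℝ) → 0 ≤ η → η ≤ (β : ℝ) → ContinuousOn (fun t => t * Vt V (Fin.cons t y') ξ η) (Set.Icc 0 1)) ∧
    (∀ {d : ℕ} {W : Set (Fin d → ℝ)}, IsSemialgebraic ℚ W → ∀ (a : Fin (m + 2)) {T Y : (Fin d → ℝ) → ℝ}, IsSemialgebraicFunOn ℚ W T → IsSemialgebraicFunOn ℚ W Y → IsSemialgebraicFunOn ℚ W fun z => fd a (T z) (Y z)) ∧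
    (∀ {d : ℕ} {W : Set (Fin d → ℝ)}, IsSemialgebraic ℚ W → ∀ (b : Fin (m + 2)) {T Y : (Fin d → ℝ) → ℝ}, IsSemialgebraicFunOn ℚ W T → IsSemialgebraicFunOn ℚ W Y → IsSemialgebraicFunOn ℚ W fun z => gd b (T z) (Y z)) ∧
    (∀ {d : ℕ} {W : Set (Fin d → ℝ)}, IsSemialgebraic ℚ W → ∀ (a : Fin (m + 2)) {T Y : (Fin d → ℝ) → ℝ}, IsSemialgebraicFunOn ℚ W T → IsSemialgebraicFunOn ℚ W Y → IsSemialgebraicFunOn ℚ W fun z => dd a (T z) (Y z)) ∧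
    (∀ {d : ℕ} {W : Set (Fin d → ℝ)}, IsSemialgebraic ℚ W → ∀ {n : ℕ} (U : Fin n → Fin (m + 2)) {X : (Fin d → ℝ) → Fin n → ℝ} {P Q : (Fin d → ℝ) → ℝ}, (∀ i, IsSemialgebraicFunOn ℚ W fun z => X z i) → IsSemialgebraicFunOn ℚ W P → IsSemialgebraicFunOn ℚ W Q → IsSemialgebraicFunOn ℚ W fun z => Ht U (X z) (P z) (Q z)) ∧
    (∀ {d : ℕ} {W : Set (Fin d → ℝ)}, IsSemialgebraic ℚ W → ∀ {n : ℕ} (V : Fin n → Fin (m + 2)) {Y : (Fin d → ℝ) → Fin n → ℝ} {P Q : (Fin d → ℝ) → ℝ}, (∀ i, IsSemialgebraicFunOn ℚ W fun z => Y z i) → IsSemialgebraicFunOn ℚ W P → IsSemialgebraicFunOn ℚ W Q → IsSemialgebraicFunOn ℚ W fun z => Vt V (Y z) (P z) (Q z)) ∧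
    (∀ {d : ℕ} {W : Set (Fin d → ℝ)}, IsSemialgebraic ℚ W → ∀ {n : ℕ} (U : Fin n → Fin (m + 2)) {X : (Fin d → ℝ) → Fin n → ℝ} {P Q : (Fin d → ℝ) → ℝ}, (∀ i, IsSemialgebraicFunOn ℚ W fun z => X z i) → IsSemialgebraicFunOn ℚ W P → IsSemialgebraicFunOn ℚ W Q → IsSemialgebraicFunOn ℚ W fun z => dHt U (X z) (P z) (Q z)) ∧
    (∀ {d : ℕ} {W : Set (Fin d → ℝ)}, IsSemialgebraic ℚ W → ∀ {n : ℕ} (V : Fin n → Fin (m + 2)) {Y : (Fin d → ℝ) → Fin n → ℝ} {P Q : (Fin d → ℝ) → ℝ}, (∀ i, IsSemialgebraicFunOn ℚ W fun z => Y z i) → IsSemialgebraicFunOn ℚ W P → IsSemialgebraicFunOn ℚ W Q → IsSemialgebraicFunOn ℚ W fun z => dVt V (Y z) (P z) (Q z)) ∧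
    (∃ C : ℝ, ∀ (a : Fin (m + 2)) (ξ η : ℝ), 0 ≤ ξ → ξ ≤ (α : ℝ) → 0 ≤ η → η ≤ (β : ℝ) → (a ≠ ℓ → |fd a ξ η| ≤ C) ∧ (a ≠ ℓ' → |gd a ξ η| ≤ C) ∧ |dd a ξ η| ≤ C ∧ (∀ η' : ℝ, 0 ≤ η' → η' ≤ (β : ℝ) → |fd a ξ η - fd a ξ η'| ≤ C * |η - η'|) ∧ (∀ ξ' : ℝ, 0 ≤ ξ' → ξ' ≤ (α : ℝ) → |gd a ξ η - gd a ξ' η| ≤ C * |ξ - ξ'|)) ∧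
    (∀ k : ℕ, ∃ C : ℝ, ∀ (U : Fin k → Fin (m + 2)) (x : Fin k → ℝ) (ξ η : ℝ), (∀ i, 0 ≤ x i ∧ x i ≤ 1) → 0 ≤ ξ → ξ ≤ (α : ℝ) → 0 ≤ η → η ≤ (β : ℝ) → |Ht U x ξ η| ≤ C ∧ |dHt U x ξ η| ≤ C ∧ (0 < k → |Ht U x ξ η| ≤ C * ξ) ∧ (∀ η' : ℝ, 0 ≤ η' → η' ≤ (β : ℝ) → |Ht U x ξ η - Ht U x ξ η'| ≤ C * ξ * |η - η'|)) ∧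
    (∀ l : ℕ, ∃ C : ℝ, ∀ (V : Fin l → Fin (m + 2)) (y : Fin l → ℝ) (ξ η : ℝ), (∀ i, 0 ≤ y i ∧ y i ≤ 1) → 0 ≤ ξ → ξ ≤ (α : ℝ) → 0 ≤ η → η ≤ (β : ℝ) → |Vt V y ξ η| ≤ C ∧ |dVt V y ξ η| ≤ C ∧ (0 < l → |Vt V y ξ η| ≤ C * η) ∧ (∀ ξ' : ℝ, 0 ≤ ξ' → ξ' ≤ (α : ℝ) → |Vt V y ξ η - Vt V y ξ' η| ≤ C * η * |ξ - ξ'|)))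

/-! ### The commutator identity -/

/-- **The four-case commutator identity** in a ring: for the insertion operators
`op_A = (A · )` or `[A, ·]` and `op_B = (B · )` or `[B, ·]`, the commutator `op_A op_B − op_B op_A`
is left multiplication by `[A, B]`, up to the extra term `−X [A, B]` when both are commutators
(Jacobi). [folklore] -/
theorem collect_op_comm_four_cases {R : Type*} [Ring R] (p q : Prop) [Decidable p] [Decidable q]
    (A B X : R) :
    (if p then A * (if q then B * X - X * B else B * X) - (if q then B * X - X * B else B * X) * A
      else A * (if q then B * X - X * B else B * X)) -
    (if q then B * (if p then A * X - X * A else A * X) - (if p then A * X - X * A else A * X) * B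
      else B * (if p then A * X - X * A else A * X)) =
    1 * (A * B - B * A) * X - (if p ∧ q then X * (A * B - B * A) * 1 else 0) := by
  by_cases hp : p <;> by_cases hq : q <;> simp only [hp, hq, if_true, if_false, and_true, and_false] <;>
    noncomm_ring

include H in
/-- **The commutator identity behind the degree `n − 2` cancellation**: with `[Z_ℓ, Z_ℓ'] = 0`
(at the level of `μ`) one has `op_a opV_b − opV_b op_a = [Z_a, Z_b] ·` for all `a, b`, so flatness
`Σ_{a,b} fd_a gd_b [Z_a, Z_b] = 0` kills the weighted sum of commutators. [cite: Drinfeld1991, §2] -/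
theorem sum_weight_commutator (μ : (DrinfeldKohnoTrunc ℚ (Fin 4) N) →ₗ[ℚ] ℚ) (X : DrinfeldKohnoTrunc ℚ (Fin 4) N)
    (x y : ℝ) (hx : 0 < x) (hxα : x < (α : ℝ)) (hy : 0 < y) (hyβ : y < (β : ℝ)) :
    ∑ a : Fin (m + 2), ∑ b : Fin (m + 2),
      fd a x y * gd b x y * ((μ (op a (opV b X)) : ℝ) - (μ (opV b (op a X)) : ℝ)) = 0 := by
  have H' := H
  obtain ⟨_, hop, hopV, _, _, _, _, _, _, _, _, _, _, _, _, _, _, _, _, _, _, _, _, _, _, hc01, hcflat, -⟩ := H'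
  -- uniform forms of the insertion operators
  have hop' : ∀ (a : Fin (m + 2)) (Y : DrinfeldKohnoTrunc ℚ (Fin 4) N),
      op a Y = if a = ℓ then Zq a * Y - Y * Zq a else Zq a * Y := by
    intro a Y
    rw [hop]
    by_cases ha : a = ℓ
    · rw [if_pos ha, if_pos ha, ha]
    · rw [if_neg ha, if_neg ha]
  have hopV' : ∀ (b : Fin (m + 2)) (Y : DrinfeldKohnoTrunc ℚ (Fin 4) N),
      opV b Y = if b = ℓ' then Zq b * Y - Y * Zq b else Zq b * Y := by
    intro b Y
    rw [hopV]
    by_cases hb : b = ℓ'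
    · rw [if_pos hb, if_pos hb, hb]
    · rw [if_neg hb, if_neg hb]
  have key : ∀ a b : Fin (m + 2), (μ (op a (opV b X)) : ℝ) - (μ (opV b (op a X)) : ℝ) =
      (μ (1 * (Zq a * Zq b - Zq b * Zq a) * X) : ℝ) := by
    intro a b
    rw [← Rat.cast_sub, ← map_sub]
    congr 1
    rw [hopV' b X, hop' a X, hop' a, hopV' b, collect_op_comm_four_cases, map_sub]
    by_cases hab : a = ℓ ∧ b = ℓ'
    · rw [if_pos hab, hab.1, hab.2, hc01, hc01, sub_zero]
    · rw [if_neg hab, map_zero, sub_zero]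
  rw [Finset.sum_congr rfl fun a _ => Finset.sum_congr rfl fun b _ => by rw [key]]
  exact hcflat μ 1 X x y hx hxα hy hyβ

/-! ### Reading mirror-layout representations over the direct cube -/

include H in
/-- **Exchanging the two variable blocks of a representation** (rule (2) along a permutation):
the new representation, on `[0,1]^{l+k+e}`, reads the old integrand with the roles of the two
blocks exchanged. [cite: KontsevichZagier2001, §1.2 rule (2)] -/
theorem collect_swap_blocks_rep {k l e : ℕ} (g : (Fin k → ℝ) → (Fin l → ℝ) → (Fin e → ℝ) → ℝ)
    (r : KZ.IntegralRep (k + l + e)) (hrd : r.domain = KZ.cube (k + l + e))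
    (hri : r.integrand = fun z => g (Xb k l e z) (Yb k l e z) (Θb k l e z)) :
    ∃ r' : KZ.IntegralRep (l + k + e), r'.domain = KZ.cube (l + k + e) ∧
      (r'.integrand = fun w => g (Yb l k e w) (Xb l k e w) (Θb l k e w)) ∧
      KZ.toPeriodAlgebra (KZ.toFormalPeriod (KZ.of r')) = KZ.toPeriodAlgebra (KZ.toFormalPeriod (KZ.of r)) := by
  -- adapted from `swap_blocks_rep` (engine playground)
  refine ⟨r.reindex (finSumFinEquiv.symm.trans ((Equiv.sumCongr (finSumFinEquiv.symm.trans
      ((Equiv.sumComm (Fin k) (Fin l)).trans finSumFinEquiv)) (Equiv.refl (Fin e))).trans finSumFinEquiv)),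
    CornerReps.reindex_domain_cube r _ hrd, ?_, CornerReps.cls_reindex r _⟩
  obtain ⟨_, _, _, _, _, _, _, _, hXb, hYb, hΘb, -⟩ := H
  funext w
  obtain ⟨h1, h2, h3⟩ := CornerBlocks.swapBlocks_blocks (k := k) (l := l) (e := e) w
  rw [CornerReps.reindex_integrand, hri]
  simp only [hXb, hYb, hΘb]
  rw [h1, h2, h3]

include H in
/-- **Exchanging two parameters of a representation** (rule (2) along a transposition): the new
representation, on the same cube, reads the old integrand with two parameter slots exchanged.
[cite: KontsevichZagier2001, §1.2 rule (2)] -/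
theorem collect_swap_params_rep {k l e : ℕ} (s₁ s₂ : Fin e) (g : (Fin k → ℝ) → (Fin l → ℝ) → (Fin e → ℝ) → ℝ)
    (r : KZ.IntegralRep (k + l + e)) (hrd : r.domain = KZ.cube (k + l + e))
    (hri : r.integrand = fun z => g (Xb k l e z) (Yb k l e z) (Θb k l e z)) :
    ∃ r' : KZ.IntegralRep (k + l + e), r'.domain = KZ.cube (k + l + e) ∧
      (r'.integrand = fun w => g (Xb k l e w) (Yb k l e w) (fun s => Θb k l e w (Equiv.swap s₁ s₂ s))) ∧
      KZ.toPeriodAlgebra (KZ.toFormalPeriod (KZ.of r')) = KZ.toPeriodAlgebra (KZ.toFormalPeriod (KZ.of r)) := by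
  refine ⟨r.reindex (Equiv.swap (Fin.natAdd (k + l) s₁) (Fin.natAdd (k + l) s₂)),
    CornerReps.reindex_domain_cube r _ hrd, ?_, CornerReps.cls_reindex r _⟩
  obtain ⟨_, _, _, _, _, _, _, _, hXb, hYb, hΘb, -⟩ := H
  funext w
  obtain ⟨h1, h2, h3⟩ := CornerBlocks.swap_params_blocks (k := k) (l := l) (e := e) s₁ s₂ w
  rw [CornerReps.reindex_integrand, hri]
  simp only [hXb, hYb, hΘb]
  rw [h1, h2, h3]

include H in
/-- **Reading a mirror-layout representation over the direct cube**: a representation on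
`[0,1]^{l+k+(e+2)}` whose integrand is a function of the blocks `y | x | θ''` with the two new
parameters transposed has the same class as a representation on `[0,1]^{k+l+(e+2)}` reading the
same function at `x | y | θ''`. [cite: KontsevichZagier2001, §1.2 rule (2)] -/
theorem collect_unmirror_rep {k l e : ℕ} (g : (Fin k → ℝ) → (Fin l → ℝ) → (Fin (e + 2) → ℝ) → ℝ)
    (r : KZ.IntegralRep (l + k + (e + 2))) (hrd : r.domain = KZ.cube (l + k + (e + 2)))
    (hri : r.integrand = fun w => g (Yb l k (e + 2) w) (Xb l k (e + 2) w)
      (fun s => Θb l k (e + 2) w (Equiv.swap (Fin.castSucc (Fin.last e)) (Fin.last (e + 1)) s))) :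
    ∃ r' : KZ.IntegralRep (k + l + (e + 2)), r'.domain = KZ.cube (k + l + (e + 2)) ∧
      (r'.integrand = fun z => g (Xb k l (e + 2) z) (Yb k l (e + 2) z) (Θb k l (e + 2) z)) ∧
      KZ.toPeriodAlgebra (KZ.toFormalPeriod (KZ.of r')) = KZ.toPeriodAlgebra (KZ.toFormalPeriod (KZ.of r)) := by
  obtain ⟨r₁, hr₁d, hr₁i, hr₁c⟩ := collect_swap_blocks_rep H (k := l) (l := k) (e := e + 2)
    (fun p q Θ => g q p (fun s => Θ (Equiv.swap (Fin.castSucc (Fin.last e)) (Fin.last (e + 1)) s))) r hrd hri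
  obtain ⟨r₂, hr₂d, hr₂i, hr₂c⟩ := collect_swap_params_rep H (k := k) (l := l) (e := e + 2)
    (Fin.castSucc (Fin.last e)) (Fin.last (e + 1))
    (fun x y Θ => g x y (fun s => Θ (Equiv.swap (Fin.castSucc (Fin.last e)) (Fin.last (e + 1)) s))) r₁ hr₁d hr₁i
  refine ⟨r₂, hr₂d, ?_, hr₂c.trans hr₁c⟩
  rw [hr₂i]
  simp only [Equiv.swap_apply_self]

/-! ### Collecting the two sides in degree `n − 1`

The mirror image of Step A (peeling `y₀`, data `(Η, Ξ)`, letters `ℓ' / ℓ`, transports exchanged)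
produces its level-`(n-1)` terms in the mirror layout `y | x | θ₀, s̄, s̄'`; reading them through
the block exchange and the transposition of the two new parameters puts them over the same cubes
as the terms of Step A. -/

include H in
/-- **Degree `n − 1` cancellation** for a letter `c ∉ {ℓ, ℓ'}` (`op c = opV c = Z_c ·`): the
`dd_c`-terms of the two sides differ by (minus) an instance of uniform nullity in degree `n − 1`.
[cite: Drinfeld1991, §2] -/
theorem collect_deg1 (μ : (DrinfeldKohnoTrunc ℚ (Fin 4) N) →ₗ[ℚ] ℚ) (c : Fin (m + 2)) (hc : c ≠ ℓ) (hc' : c ≠ ℓ')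
    (k l e : ℕ) (Ξ₂ Η₂ ρ₂ : (Fin (e + 2) → ℝ) → ℝ)
    (W₁ : KZ.IntegralRep (k + l + (e + 2))) (hW₁d : W₁.domain = KZ.cube (k + l + (e + 2)))
    (hW₁i : W₁.integrand = fun w => ρ₂ (Θb k l (e + 2) w) *
      (dd c (Ξ₂ (Θb k l (e + 2) w)) (Η₂ (Θb k l (e + 2) w)) *
        Bf (μ ∘ₗ op c) (Xb k l (e + 2) w) (Yb k l (e + 2) w) (Ξ₂ (Θb k l (e + 2) w)) (Η₂ (Θb k l (e + 2) w))))
    (W₁' : KZ.IntegralRep (l + k + (e + 2))) (hW₁'d : W₁'.domain = KZ.cube (l + k + (e + 2)))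
    (hW₁'i : W₁'.integrand = fun w =>
      ρ₂ (fun s => Θb l k (e + 2) w (Equiv.swap (Fin.castSucc (Fin.last e)) (Fin.last (e + 1)) s)) *
      (dd c (Ξ₂ (fun s => Θb l k (e + 2) w (Equiv.swap (Fin.castSucc (Fin.last e)) (Fin.last (e + 1)) s)))
          (Η₂ (fun s => Θb l k (e + 2) w (Equiv.swap (Fin.castSucc (Fin.last e)) (Fin.last (e + 1)) s))) *
        Af (μ ∘ₗ opV c) (Yb l k (e + 2) w) (Xb l k (e + 2) w)
          (Ξ₂ (fun s => Θb l k (e + 2) w (Equiv.swap (Fin.castSucc (Fin.last e)) (Fin.last (e + 1)) s)))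
          (Η₂ (fun s => Θb l k (e + 2) w (Equiv.swap (Fin.castSucc (Fin.last e)) (Fin.last (e + 1)) s)))))
    (Φ : KZ.IntegralRep (k + l + (e + 2))) (hΦd : Φ.domain = KZ.cube (k + l + (e + 2)))
    (hΦi : Φ.integrand = fun w => ρ₂ (Θb k l (e + 2) w) * dd c (Ξ₂ (Θb k l (e + 2) w)) (Η₂ (Θb k l (e + 2) w)) *
      F (μ ∘ₗ op c) (Xb k l (e + 2) w) (Yb k l (e + 2) w) (Ξ₂ (Θb k l (e + 2) w)) (Η₂ (Θb k l (e + 2) w))) :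
    KZ.toPeriodAlgebra (KZ.toFormalPeriod (KZ.of W₁)) - KZ.toPeriodAlgebra (KZ.toFormalPeriod (KZ.of W₁')) =
      - KZ.toPeriodAlgebra (KZ.toFormalPeriod (KZ.of Φ)) := by
  have H' := H
  obtain ⟨_, hop, hopV, _, _, _, _, hF, -⟩ := H'
  have hopc : op c = opV c := LinearMap.ext fun X => by rw [hop, hopV, if_neg hc, if_neg hc']
  -- read `W₁'` over the direct cube
  obtain ⟨r, hrd, hri, hrc⟩ := collect_unmirror_rep H (k := k) (l := l) (e := e)
    (fun x y Θ => ρ₂ Θ * (dd c (Ξ₂ Θ) (Η₂ Θ) * Af (μ ∘ₗ opV c) x y (Ξ₂ Θ) (Η₂ Θ))) W₁' hW₁'d hW₁'i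
  -- integrand additivity `r = W₁ + Φ` (exact, on the whole cube)
  have hadd : EqOn r.integrand (W₁.integrand + Φ.integrand) r.domain := by
    intro w _
    simp only [Pi.add_apply, hri, hW₁i, hΦi, hF, ← hopc]
    ring
  rw [← hrc, CornerReps.cls_add (hW₁d.trans hrd.symm) (hΦd.trans hrd.symm) hadd]
  abel

end AbstractEngine

/-- **Hook `cornerEngineCollect_op_comm`** (registered form of `collect_op_comm_four_cases`): the
four-case commutator identity of the insertion operators in an arbitrary ring. [folklore] -/
theorem cornerEngineCollect_op_comm : ∀ (R : Type) [Ring R] (p q : Prop) [Decidable p] [Decidable q] (A B X : R), (if p then A * (if q then B * X - X * B else B * X) - (if q then B * X - X * B else B * X) * A else A * (if q then B * X - X * B else B * X)) - (if q then B * (if p then A * X - X * A else A * X) - (if p then A * X - X * A else A * X) * B else B * (if p then A * X - X * A else A * X)) = 1 * (A * B - B * A) * X - (if p ∧ q then X * (A * B - B * A) * 1 else 0) :=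
  fun _ _ p q _ _ A B X => collect_op_comm_four_cases p q A B X

end Summit.KontsevichZagierPeriods.FurushoPentagon.PentagonInKZ
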